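import Mathlib
import Summits.Ventures.PercRepro2.ZMeanProof
import Summits.Ventures.PercRepro2.BHKEvents
import Summits.Ventures.PercRepro2.PocketBHK

/-!
# Row-wise Harris: `E[1_Q g_o(C₂) g_b(C₂)] ≤ P(Q, o ∈ C₁, b ∈ C₁)` (blind cell PercRepro2, night-1 g8)

Exploring the root cluster `C₂ = C(a₂)` on `Q = {a₁ ↮ a₂}`: given `C₂ = W` the two events
`{o ∈ C₁}`, `{b ∈ C₁}` are the increasing events `{a₁ ↔ o}`, `{a₁ ↔ b}` of the residual graph
`G ∖ W`, so by Harris in the residual graph `P_{G∖W}(a₁ ↔ o, a₁ ↔ b) ≥ g_o(W) g_b(W)`; summing the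
rows (`prob_clusterIn_inter_eq_expect`) gives the slack `h_LL = P(Q, oL, bL) − E[1_Q g_o g_b] ≥ 0`
of NIGHT1-G8.md §1 (one of the six analytic inputs of the class-O certificate).  `Eprod'` and
`gshare` are those of `PocketBHK.lean`.
-/

namespace Summit.Ventures.PercRepro2

open UnionCluster CovForm PendantRoot

namespace PocketConn

variable {V : Type*} {E : Type*} [Fintype E] [DecidableEq E] [Fintype V] [DecidableEq V]
  {R : Type*} [Field R] [LinearOrder R] [IsStrictOrderedRing R]

variable (p : E → R) (ends : E → Sym2 V)

omit [Fintype E] [DecidableEq E] [Fintype V] [DecidableEq V] in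
/-- `delConfig` is monotone in the configuration. -/
lemma delConfig_mono_config' (W : Set V) {ω ω' : Config E} (h : ω ≤ ω') :
    delConfig ends W ω ≤ delConfig ends W ω' := by
  intro e
  by_cases he : e ∈ touches ends W
  · rw [delConfig_apply_of_mem he, delConfig_apply_of_mem he]
  · rw [delConfig_apply_of_notMem he, delConfig_apply_of_notMem he]
    exact h e

omit [Fintype E] [DecidableEq E] [Fintype V] [DecidableEq V] in
/-- For an up-set `𝓥`, `{C_t ∈ 𝓥 in G ∖ W}` is an increasing event. -/
lemma isUpperSet_delCluster (W : Set V) (t : V) {𝓥 : Set (Set V)} (h𝓥 : IsUpperSet 𝓥) :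
    IsUpperSet {ω : Config E | cluster ends (delConfig ends W ω) t ∈ 𝓥} := by
  intro ω ω' h hω
  exact h𝓥 (cluster_mono (delConfig_mono_config' ends W h) t) hω

omit [Fintype V] [DecidableEq V] in
/-- **Harris in the residual graph**: `g_o(W) · g_b(W) ≤ P_{G∖W}(a₁ ↔ o, a₁ ↔ b)`. -/
lemma gshare_mul_gshare_le (hp : IsProbVec p) (a₁ o b : V) (W : Set V) :
    gshare p ends a₁ o W * gshare p ends a₁ b W ≤
      delClusterProb p ends a₁ {S : Set V | o ∈ S ∧ b ∈ S} W := by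
  unfold gshare delClusterProb
  have h := prob_mul_prob_le_prob_inter hp
    (isUpperSet_delCluster ends W a₁ (𝓥 := {S : Set V | o ∈ S}) (fun _ _ hST h => hST h))
    (isUpperSet_delCluster ends W a₁ (𝓥 := {S : Set V | b ∈ S}) (fun _ _ hST h => hST h))
  refine h.trans (le_of_eq ?_)
  congr 1

omit [DecidableEq V] in
/-- **Row-wise Harris**: `E[1_Q g_o(C₂) g_b(C₂)] ≤ P(Q, o ∈ C₁, b ∈ C₁)`. -/
theorem Eprod'_le (hp : IsProbVec p) (o a₁ a₂ b : V) :
    Eprod' p ends o a₁ a₂ b ≤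
      prob p (connEvent ends a₁ o ∩ connEvent ends a₁ b ∩ (connEvent ends a₂ a₁)ᶜ) := by
  have key := prob_clusterIn_inter_eq_expect p ends a₂ a₁ Set.univ {S : Set V | o ∈ S ∧ b ∈ S}
  have eu : clusterInEvent ends a₂ Set.univ = Set.univ := by ext; simp [clusterInEvent]
  have ev : clusterInEvent ends a₁ {S : Set V | o ∈ S ∧ b ∈ S} =
      connEvent ends a₁ o ∩ connEvent ends a₁ b := by
    ext ω
    simp only [mem_clusterInEvent, Set.mem_setOf_eq, mem_cluster, Set.mem_inter_iff, mem_connEvent]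
  rw [eu, Set.univ_inter, ev] at key
  rw [key]
  unfold Eprod'
  refine expect_mono hp fun ω => ?_
  simp only [Set.indicator_univ, Pi.one_apply, one_mul]
  have hind : 0 ≤ ((connEvent ends a₂ a₁)ᶜ).indicator (1 : Config E → R) ω :=
    Set.indicator_nonneg (fun _ _ => zero_le_one) _
  exact mul_le_mul_of_nonneg_right (gshare_mul_gshare_le p ends hp a₁ o b _) hind

end PocketConn

end Summit.Ventures.PercRepro2
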